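import Literature.NumberTheory.Sieve.PolynomialCongruencesMeanValues
import Literature.NumberTheory.Sieve.RankinComposedTail
import Mathlib.NumberTheory.SmoothNumbers
import Mathlib.Analysis.Complex.ExponentialBounds
import HarnessLib

/-!
# Goldfeld–Schinzel's harmonic tail: `Σ_{Z ≤ a ≤ Y} g(a)/a` is small against `Σ_{a < Z} g(a)/a`
# for a sub-quadratic multiplicative `g ≥ 0` (the estimates (4)–(5) of the proof of Lemma 1)

Topic `Literature/NumberTheory/LFunctions` (namespace `Literature.NumberTheory.LFunctions.GSTail`).
Everything in this file is PROVED (theorems only; no definitions, no named facts).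

D. M. Goldfeld, A. Schinzel, *On Siegel's zero*, Ann. Scuola Norm. Sup. Pisa (4) **2** (1975), §2,
proof of Lemma 1, pp. 573–575: with `S = Σ_{¼√|d| < a < ¼√|d| f(d)} (1/a)` (weighted by the root
count `ν(a) = ρ_d(a)`), "To estimate the sum `S`, we divide it into two sums `S₁` and `S₂`. In the
sum `S₁`, we gather all the terms `1/a` such that `a` has at least one prime power factor
`p^α > l(d) = d^{1/21 log log|d|}`, `p^α ∥ a`, and in `S₂` all the other terms. [...] Clearly
`S₁ ≤ Σ' (1/a) Σ'' ν(p^α) p^{−α} ≤ Σ' (1/a) Σ'' 2p^{−α}` where `Σ''` goes over all prime powers `p^α`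
with `max(l(d), √|d|/4a) < p^α ≤ √|d| f(d)/4a`. Now, by a well known result of Mertens
`Σ_{p^α < x} p^{−α} = log log x + c + O((log x)^{−1})` [...] This gives
`Σ'' p^{−α} ≤ (log f(d) + O(1))/log l(d) ≪ (log log|d|)²/log d` and we get (4)
`S₁ = O((log log|d|)²/log|d|) Σ' 1/a`. [...] (5) `S₂ = O((log|d|)^{−3})`."

We prove the two estimates for an ARBITRARY multiplicative `g ≥ 0` with `g(p^{k+1}) ≤ 2 g(p^k)`
and `g(p^k) ≤ 2` (`k ≥ 1`) — the properties of `ν = ρ_d` that the source uses — and arbitrary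
`1 ≤ Z ≤ Y ≤ l·Z`, `l ≥ 16`:

* `GSTail.rough_part_le` — the terms `a ∈ [Z, Y]` with a prime factor `p > l`:
  `≤ 2·((log(2Y/Z) + 16)/log(l/2))·Σ_{m < Z} g(m)/m` (as printed: `a = m·p` with `m = a/p < Z`,
  `g(a) ≤ 2 g(m)`, and Mertens' theorem with rate on the window `p ∈ (max(l, Z/m)/2, Y/m]`,
  `Mertens.abs_primeRecipSum_sub_le`; the source pulls out the full prime power `p^α ∥ a`, we pull
  out one prime `p`, which the hypothesis `g(p^{k+1}) ≤ 2g(p^k)` permits);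
* `GSTail.smooth_part_le` — the `l`-smooth terms `a ∈ [Z, Y]`:
  `≤ Z^{−1/log l}·exp(2(log log l + K₀))` with the absolute `K₀ = M + 8/log 16 + 3 + 24e + C₀` (`M` the
  Meissel–Mertens constant, `C₀ = 2ζ(6/5)` of `RankinComposed.prod_inv_le_exp`). DEVIATION from the
  printed road: the source counts `ω(a) ≥ k₀ = log(¼√|d|)/log l(d)` distinct prime factors and uses
  Stirling; we use RANKIN's trick `1/a ≤ Z^{−θ} a^{−(1−θ)}`, `θ = 1/log l`, the Euler product over
  `l`-smooth numbers (`BombieriSieve.sum_le_prod_tsum_of_factored`) and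
  `∏_{p ≤ l} (1 − p^{−σ})^{−1} ≤ exp(Σ p^{−σ} + C₀)`, `Σ_{p ≤ l} (p^θ − 1)/p ≤ 3 + 24 l^θ`
  (`RankinComposed.prod_inv_le_exp`, `RankinComposed.sum_excess_le`), which gives the same
  conclusion (a negative power of `log|d|` once `log l = log|d|/(21 log log|d|)`, `Z = ¼√|d|`);
* `GSTail.tail_le` — the sum of the two.

## References

* D. M. Goldfeld, A. Schinzel, On Siegel's zero, Ann. Scuola Norm. Sup. Pisa (4) 2 (1975), §2,
  proof of Lemma 1, (3)–(5), pp. 573–575. [GoldfeldSchinzel1975]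
* H. L. Montgomery, R. C. Vaughan, *Multiplicative Number Theory I*, CUP 2007, §7.1 (Rankin's
  method). [MontgomeryVaughan2007]
-/

noncomputable section

open Finset Real

namespace Literature.NumberTheory.LFunctions.GSTail

open Literature.NumberTheory.Sieve (RankinComposed.C₀ RankinComposed.prod_inv_le_exp
  RankinComposed.sum_excess_le BombieriSieve.sum_le_prod_tsum_of_factored sum_inv_primes_Ioc_le)
open Literature.NumberTheory.LFunctions.Mertens (primeRecipSum meisselMertens abs_primeRecipSum_sub_le)

/-! ### `g(mp) ≤ 2 g(m)` -/

/-- If `g` is multiplicative with `g(p^{k+1}) ≤ 2 g(p^k)` at every prime power, then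
`g(m·p) ≤ 2 g(m)` for every `m ≥ 1` and prime `p` (write `m = p^k m'`, `p ∤ m'`).
[cite: GoldfeldSchinzel1975, §2 proof of Lemma 1 (4) p. 573–574] -/
theorem apply_mul_prime_le {g : ArithmeticFunction ℝ} (hmul : g.IsMultiplicative)
    (h0 : ∀ n, 0 ≤ g n) (hsucc : ∀ p k : ℕ, p.Prime → g (p ^ (k + 1)) ≤ 2 * g (p ^ k))
    {m p : ℕ} (hm : m ≠ 0) (hp : p.Prime) : g (m * p) ≤ 2 * g m := by
  set k := m.factorization p with hk
  have hsplit : p ^ k * (m / p ^ k) = m := Nat.ordProj_mul_ordCompl_eq_self m p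
  have hcop : Nat.Coprime p (m / p ^ k) := Nat.coprime_ordCompl hp hm
  have hcop1 : Nat.Coprime (p ^ (k + 1)) (m / p ^ k) := Nat.Coprime.pow_left _ hcop
  have hcop0 : Nat.Coprime (p ^ k) (m / p ^ k) := Nat.Coprime.pow_left _ hcop
  have e1 : m * p = p ^ (k + 1) * (m / p ^ k) := by
    conv_lhs => rw [← hsplit]
    ring
  rw [e1, hmul.map_mul_of_coprime hcop1]
  conv_rhs => rw [← hsplit, hmul.map_mul_of_coprime hcop0]
  have := hsucc p k hp
  have hg' := h0 (m / p ^ k)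
  nlinarith

/-! ### Mertens on a window of primes

`Σ_{X < p ≤ y} 1/p ≤ log log y − log log X + 16/log X` (`2 ≤ X ≤ y`) is the tree's
`Literature.NumberTheory.Sieve.sum_inv_primes_Ioc_le` (two applications of Mertens' theorem with rate,
`Mertens.abs_primeRecipSum_sub_le`) — the source's "well known result of Mertens". -/

/-- **The window sum `Σ''` (primes only).** For `l ≥ 16`, `0 < Z ≤ Y`, `m ≥ 1`: the primes `p > l`
with `Z ≤ mp ≤ Y` have `Σ 1/p ≤ (log(2Y/Z) + 16)/log(l/2)` ("`Σ'' p^{−α} ≤ (log f(d) + O(1))/log l(d)`").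
[cite: GoldfeldSchinzel1975, §2 proof of Lemma 1 (4) p. 574] -/
theorem sum_inv_primes_window_le {l : ℕ} (hl : 16 ≤ l) {Z Y : ℝ} (hZ : 0 < Z) (hZY : Z ≤ Y)
    {m : ℕ} (hm : 1 ≤ m) :
    ∑ p ∈ (Icc 1 ⌊Y⌋₊).filter
        (fun p : ℕ => p.Prime ∧ l < p ∧ Z ≤ (m : ℝ) * p ∧ (m : ℝ) * p ≤ Y), 1 / (p : ℝ) ≤
      (Real.log (2 * Y / Z) + 16) / Real.log ((l : ℝ) / 2) := by
  have hlR : (16 : ℝ) ≤ l := by exact_mod_cast hl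
  have hmR : (1 : ℝ) ≤ m := by exact_mod_cast hm
  have hm0 : (0 : ℝ) < m := by linarith
  have hlog2 : 0 < Real.log ((l : ℝ) / 2) := Real.log_pos (by linarith)
  have hRHS : 0 ≤ (Real.log (2 * Y / Z) + 16) / Real.log ((l : ℝ) / 2) := by
    refine div_nonneg (add_nonneg (Real.log_nonneg ?_) (by norm_num)) hlog2.le
    rw [le_div_iff₀ hZ]; linarith
  set X : ℝ := max (l : ℝ) (Z / m) / 2 with hX
  set y : ℝ := Y / m with hy
  have hXl : (l : ℝ) / 2 ≤ X := by
    rw [hX]; exact div_le_div_of_nonneg_right (le_max_left _ _) (by norm_num)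
  have hXZ : Z / m / 2 ≤ X := by
    rw [hX]; exact div_le_div_of_nonneg_right (le_max_right _ _) (by norm_num)
  have hX2 : (2 : ℝ) ≤ X := by linarith
  have hXpos : 0 < X := by linarith
  set Q := (Icc 1 ⌊Y⌋₊).filter
    (fun p : ℕ => p.Prime ∧ l < p ∧ Z ≤ (m : ℝ) * p ∧ (m : ℝ) * p ≤ Y) with hQ
  -- `Q ⊆ {primes p ≤ y with X < p}`
  have hsub : Q ⊆ (Nat.primesLE ⌊y⌋₊).filter (fun p : ℕ => X < (p : ℝ)) := by
    intro p hp
    rw [hQ, mem_filter, mem_Icc] at hp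
    obtain ⟨-, hpr, hlp, hZp, hpY⟩ := hp
    have hpy : (p : ℝ) ≤ y := by rw [hy, le_div_iff₀ hm0]; linarith
    rw [mem_filter, Nat.mem_primesLE]
    refine ⟨⟨Nat.le_floor hpy, hpr⟩, ?_⟩
    have hlp' : (l : ℝ) < p := by exact_mod_cast hlp
    have hZmp : Z / m ≤ p := by rw [div_le_iff₀ hm0]; linarith
    have hZm0 : 0 < Z / m := div_pos hZ hm0
    rw [hX]
    rcases le_total (l : ℝ) (Z / m) with h | h
    · rw [max_eq_right h]; linarith
    · rw [max_eq_left h]; linarith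
  rcases Q.eq_empty_or_nonempty with hQe | ⟨p₀, hp₀⟩
  · rw [hQe, sum_empty]; exact hRHS
  -- `X ≤ y` thanks to a witness
  have hXy : X ≤ y := by
    have h := hsub hp₀
    rw [mem_filter, Nat.mem_primesLE] at h
    have h1 : (p₀ : ℝ) ≤ ⌊y⌋₊ := by exact_mod_cast h.1.1
    have h2 : (⌊y⌋₊ : ℝ) ≤ y := Nat.floor_le (by
      rw [hy]; exact div_nonneg (le_trans hZ.le hZY) hm0.le)
    linarith [h.2]
  have hmain := sum_inv_primes_Ioc_le hX2 hXy
  have hle1 : ∑ p ∈ Q, 1 / (p : ℝ) ≤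
      ∑ p ∈ (Nat.primesLE ⌊y⌋₊).filter (fun p : ℕ => X < (p : ℝ)), (p : ℝ)⁻¹ := by
    rw [show (fun p : ℕ => 1 / (p : ℝ)) = fun p : ℕ => (p : ℝ)⁻¹ from funext fun p => one_div _]
    exact sum_le_sum_of_subset_of_nonneg hsub fun _ _ _ => by positivity
  refine hle1.trans (hmain.trans ?_)
  -- `log log y − log log X ≤ log(2Y/Z)/log X`, `16/log X ≤ 16/log(l/2)`
  have hlogX : 0 < Real.log X := Real.log_pos (by linarith)
  have hlogX' : Real.log ((l : ℝ) / 2) ≤ Real.log X := Real.log_le_log (by linarith) hXl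
  have hypos : 0 < y := lt_of_lt_of_le hXpos hXy
  have hlogy : Real.log X ≤ Real.log y := Real.log_le_log hXpos hXy
  have hlogy0 : 0 < Real.log y := lt_of_lt_of_le hlogX hlogy
  have hyX : y / X ≤ 2 * Y / Z := by
    have hYm : 0 ≤ Y / m := div_nonneg (le_trans hZ.le hZY) hm0.le
    calc y / X ≤ (Y / m) / (Z / m / 2) := by
          rw [hy]; exact div_le_div_of_nonneg_left hYm (by positivity) hXZ
      _ = 2 * Y / Z := by field_simp
  have hdiff : Real.log (Real.log y) - Real.log (Real.log X) ≤ Real.log (2 * Y / Z) / Real.log X := by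
    rw [← Real.log_div hlogy0.ne' hlogX.ne']
    have h1 : Real.log (Real.log y / Real.log X) ≤ Real.log y / Real.log X - 1 :=
      Real.log_le_sub_one_of_pos (div_pos hlogy0 hlogX)
    have h2 : Real.log y / Real.log X - 1 = Real.log (y / X) / Real.log X := by
      rw [Real.log_div hypos.ne' hXpos.ne']; field_simp
    have h3 : Real.log (y / X) ≤ Real.log (2 * Y / Z) :=
      Real.log_le_log (div_pos hypos hXpos) hyX
    rw [h2] at h1
    exact h1.trans (div_le_div_of_nonneg_right h3 hlogX.le)
  have hlog2YZ : 0 ≤ Real.log (2 * Y / Z) := Real.log_nonneg (by rw [le_div_iff₀ hZ]; linarith)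
  have h16 : 16 / Real.log X ≤ 16 / Real.log ((l : ℝ) / 2) :=
    div_le_div_of_nonneg_left (by norm_num) hlog2 hlogX'
  have hA : Real.log (2 * Y / Z) / Real.log X ≤ Real.log (2 * Y / Z) / Real.log ((l : ℝ) / 2) :=
    div_le_div_of_nonneg_left hlog2YZ hlog2 hlogX'
  rw [add_div]
  linarith

/-! ### The rough part `S₁` -/

/-- **(4): the terms with a large prime factor.** For `g` multiplicative, `≥ 0`, with
`g(p^{k+1}) ≤ 2g(p^k)`, and `1 ≤ Z ≤ Y ≤ l·Z`, `l ≥ 16`: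
`Σ_{Z ≤ a ≤ Y, ∃ p ∣ a prime, p > l} g(a)/a ≤ 2·((log(2Y/Z) + 16)/log(l/2))·Σ_{1 ≤ m < Z} g(m)/m`
(each such `a` is `m·p` with `p` its largest prime factor, `m = a/p < Y/l ≤ Z`, `g(a) ≤ 2g(m)`; then
the window estimate, uniformly in `m`). [cite: GoldfeldSchinzel1975, §2 proof of Lemma 1 (4) p. 573–574] -/
theorem rough_part_le {g : ArithmeticFunction ℝ} (hmul : g.IsMultiplicative) (h0 : ∀ n, 0 ≤ g n)
    (hsucc : ∀ p k : ℕ, p.Prime → g (p ^ (k + 1)) ≤ 2 * g (p ^ k))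
    {l : ℕ} (hl : 16 ≤ l) {Z Y : ℝ} (hZ : 1 ≤ Z) (hZY : Z ≤ Y) (hYl : Y ≤ l * Z) :
    ∑ a ∈ (Icc 1 ⌊Y⌋₊).filter (fun a : ℕ => Z ≤ (a : ℝ) ∧ ∃ p ∈ a.primeFactors, l < p),
        g a / (a : ℝ) ≤
      2 * ((Real.log (2 * Y / Z) + 16) / Real.log ((l : ℝ) / 2)) *
        ∑ m ∈ Ico 1 ⌈Z⌉₊, g m / (m : ℝ) := by
  have hZ0 : 0 < Z := by linarith
  have hlR : (0 : ℝ) < l := by exact_mod_cast (show 0 < l by omega)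
  set N := ⌊Y⌋₊ with hN
  set W : ℝ := (Real.log (2 * Y / Z) + 16) / Real.log ((l : ℝ) / 2) with hW
  set A₁ := (Icc 1 N).filter (fun a : ℕ => Z ≤ (a : ℝ) ∧ ∃ p ∈ a.primeFactors, l < p) with hA₁
  -- the largest prime factor `P a = a.primeFactors.sup id`
  have hP : ∀ a ∈ A₁, (a.primeFactors.sup id).Prime ∧ a.primeFactors.sup id ∣ a ∧
      l < a.primeFactors.sup id := by
    intro a ha
    rw [hA₁, mem_filter] at ha
    obtain ⟨-, -, p, hp, hlp⟩ := ha
    have hne : a.primeFactors.Nonempty := ⟨p, hp⟩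
    obtain ⟨r, hr, hreq⟩ := Finset.exists_mem_eq_sup a.primeFactors hne id
    rw [hreq, id]
    refine ⟨Nat.prime_of_mem_primeFactors hr, Nat.dvd_of_mem_primeFactors hr, ?_⟩
    have : p ≤ a.primeFactors.sup id := Finset.le_sup (f := id) hp
    rw [hreq, id] at this
    omega
  -- the map `a ↦ (a / P a, P a)` and its target set
  set φ : ℕ → ℕ × ℕ := fun a => (a / a.primeFactors.sup id, a.primeFactors.sup id) with hφ
  have hφa : ∀ a ∈ A₁, (a / a.primeFactors.sup id) * a.primeFactors.sup id = a :=
    fun a ha => Nat.div_mul_cancel (hP a ha).2.1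
  set S := (Ico 1 ⌈Z⌉₊ ×ˢ Icc 1 N).filter (fun x : ℕ × ℕ =>
    x.2.Prime ∧ l < x.2 ∧ Z ≤ (x.1 : ℝ) * x.2 ∧ (x.1 : ℝ) * x.2 ≤ Y) with hS
  set F : ℕ × ℕ → ℝ := fun x => 2 * (g x.1 / (x.1 : ℝ)) * (1 / (x.2 : ℝ)) with hF
  have hF0 : ∀ x, 0 ≤ F x := fun x => by simp only [hF]; exact mul_nonneg (mul_nonneg (by norm_num)
    (div_nonneg (h0 _) (Nat.cast_nonneg _))) (by positivity)
  -- facts about `a ∈ A₁`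
  have hmem : ∀ a ∈ A₁, 1 ≤ a / a.primeFactors.sup id ∧ ((a / a.primeFactors.sup id : ℕ) : ℝ) < Z ∧
      1 ≤ a.primeFactors.sup id ∧ a.primeFactors.sup id ≤ N ∧
      Z ≤ ((a / a.primeFactors.sup id : ℕ) : ℝ) * (a.primeFactors.sup id) ∧
      ((a / a.primeFactors.sup id : ℕ) : ℝ) * (a.primeFactors.sup id) ≤ Y := by
    intro a ha
    obtain ⟨hPp, hPd, hlP⟩ := hP a ha
    have ha' := ha
    rw [hA₁, mem_filter, mem_Icc] at ha'
    obtain ⟨⟨ha1, haN⟩, hZa, -⟩ := ha'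
    have haY : (a : ℝ) ≤ Y := by
      have : (a : ℝ) ≤ N := by exact_mod_cast haN
      exact this.trans (Nat.floor_le (by linarith))
    set m := a / a.primeFactors.sup id with hm
    set P := a.primeFactors.sup id with hPdef
    have hmP : m * P = a := hφa a ha
    have hmPR : (m : ℝ) * P = a := by exact_mod_cast hmP
    have hP0 : (0 : ℝ) < P := by exact_mod_cast hPp.pos
    have hm1 : 1 ≤ m := by
      rcases Nat.eq_zero_or_pos m with h | h
      · rw [h, zero_mul] at hmP; omega
      · exact h
    have hlP' : (l : ℝ) < P := by exact_mod_cast hlP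
    have hmZ : (m : ℝ) < Z := by
      -- `m·P = a ≤ Y ≤ lZ < P Z`
      by_contra hcon
      push Not at hcon
      have h1 : Z * P ≤ (m : ℝ) * P := mul_le_mul_of_nonneg_right hcon hP0.le
      have h2 : (l : ℝ) * Z < P * Z := mul_lt_mul_of_pos_right hlP' hZ0
      nlinarith
    refine ⟨hm1, hmZ, hPp.one_lt.le, ?_, by rw [hmPR]; exact hZa, by rw [hmPR]; exact haY⟩
    exact le_trans (Nat.le_of_dvd (by omega) hPd) haN
  -- step 1: termwise `g a / a ≤ F (φ a)`
  have hstep1 : ∑ a ∈ A₁, g a / (a : ℝ) ≤ ∑ a ∈ A₁, F (φ a) := by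
    refine sum_le_sum fun a ha => ?_
    obtain ⟨hPp, hPd, hlP⟩ := hP a ha
    obtain ⟨hm1, -, -, -, -, -⟩ := hmem a ha
    have hmP := hφa a ha
    simp only [hF, hφ]
    set m := a / a.primeFactors.sup id
    set P := a.primeFactors.sup id
    have hm0 : (0 : ℝ) < m := by exact_mod_cast hm1
    have hP0 : (0 : ℝ) < P := by exact_mod_cast hPp.pos
    have hga : g a ≤ 2 * g m := by
      rw [← hmP]; exact apply_mul_prime_le hmul h0 hsucc (by omega) hPp
    have haR : (a : ℝ) = m * P := by rw [← hmP]; push_cast; ring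
    rw [haR, div_le_iff₀ (by positivity)]
    calc g a ≤ 2 * g m := hga
      _ = 2 * (g m / m) * (1 / P) * (m * P) := by field_simp
  -- step 2: injectivity and the image
  have hinj : Set.InjOn φ A₁ := by
    intro a ha b hb hab
    simp only [hφ, Prod.mk.injEq] at hab
    rw [← hφa a ha, ← hφa b hb, hab.1, hab.2]
  have himage : A₁.image φ ⊆ S := by
    intro x hx
    rw [mem_image] at hx
    obtain ⟨a, ha, rfl⟩ := hx
    obtain ⟨hm1, hmZ, hP1, hPN, hZmP, hmPY⟩ := hmem a ha
    obtain ⟨hPp, -, hlP⟩ := hP a ha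
    simp only [hS, hφ, mem_filter, mem_product, mem_Ico, mem_Icc]
    exact ⟨⟨⟨hm1, Nat.lt_ceil.mpr hmZ⟩, hP1, hPN⟩, hPp, hlP, hZmP, hmPY⟩
  have hstep2 : ∑ a ∈ A₁, F (φ a) ≤ ∑ x ∈ S, F x := by
    rw [← sum_image hinj]
    exact sum_le_sum_of_subset_of_nonneg himage fun x _ _ => hF0 x
  -- step 3: iterate the sum over `S`
  have hstep3 : ∑ x ∈ S, F x = ∑ m ∈ Ico 1 ⌈Z⌉₊, 2 * (g m / (m : ℝ)) *
      ∑ p ∈ (Icc 1 N).filter (fun p : ℕ => p.Prime ∧ l < p ∧ Z ≤ (m : ℝ) * p ∧ (m : ℝ) * p ≤ Y),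
        1 / (p : ℝ) := by
    rw [hS, sum_filter, sum_product]
    refine sum_congr rfl fun m _ => ?_
    rw [mul_sum, ← sum_filter]
  -- step 4: the window bound, uniformly in `m`
  have hstep4 : ∑ m ∈ Ico 1 ⌈Z⌉₊, 2 * (g m / (m : ℝ)) *
      ∑ p ∈ (Icc 1 N).filter (fun p : ℕ => p.Prime ∧ l < p ∧ Z ≤ (m : ℝ) * p ∧ (m : ℝ) * p ≤ Y),
        1 / (p : ℝ) ≤ ∑ m ∈ Ico 1 ⌈Z⌉₊, 2 * (g m / (m : ℝ)) * W := by
    refine sum_le_sum fun m hm => ?_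
    have hm1 : 1 ≤ m := (mem_Ico.mp hm).1
    refine mul_le_mul_of_nonneg_left ?_ (mul_nonneg (by norm_num) (div_nonneg (h0 _) (Nat.cast_nonneg _)))
    exact sum_inv_primes_window_le hl hZ0 hZY hm1
  calc ∑ a ∈ A₁, g a / (a : ℝ) ≤ ∑ a ∈ A₁, F (φ a) := hstep1
    _ ≤ ∑ x ∈ S, F x := hstep2
    _ = _ := hstep3
    _ ≤ ∑ m ∈ Ico 1 ⌈Z⌉₊, 2 * (g m / (m : ℝ)) * W := hstep4
    _ = 2 * W * ∑ m ∈ Ico 1 ⌈Z⌉₊, g m / (m : ℝ) := by rw [mul_sum]; exact sum_congr rfl fun m _ => by ring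

/-! ### The smooth part `S₂` by Rankin's trick -/

/-- `log 16 > 2.77`, so that `θ = 1/log l ≤ 2/5` for `l ≥ 16`. [cite: GoldfeldSchinzel1975, §2 proof of Lemma 1 (5) p. 574] -/
theorem log_sixteen_gt : (2.77 : ℝ) < Real.log 16 := by
  have h := Real.log_two_gt_d9
  rw [show (16 : ℝ) = 2 ^ 4 by norm_num, Real.log_pow]
  push_cast
  linarith

/-- The local Euler factor: for `g ≥ 0` with `g(1) = 1`, `g(p^k) ≤ 2` (`k ≥ 1`), and `0 < x = p^{−σ} < 1`,
`Σ_e g(p^e) x^e ≤ (1 + x)/(1 − x) ≤ ((1 − x)⁻¹)²`. [cite: MontgomeryVaughan2007, §7.1 (Rankin's method)] -/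
theorem tsum_local_le {g : ArithmeticFunction ℝ} (hg1 : g 1 = 1) (h0 : ∀ n, 0 ≤ g n)
    (htwo : ∀ p k : ℕ, p.Prime → 1 ≤ k → g (p ^ k) ≤ 2) {p : ℕ} (hp : p.Prime) {σ : ℝ} (hσ : 0 < σ) :
    Summable (fun e : ℕ => g (p ^ e) * ((p : ℝ) ^ (-σ)) ^ e) ∧
      ∑' e : ℕ, g (p ^ e) * ((p : ℝ) ^ (-σ)) ^ e ≤ ((1 - (p : ℝ) ^ (-σ))⁻¹) ^ 2 := by
  set x : ℝ := (p : ℝ) ^ (-σ) with hx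
  have hp1 : (1 : ℝ) < p := by exact_mod_cast hp.one_lt
  have hx0 : 0 < x := Real.rpow_pos_of_pos (by linarith) _
  have hx1 : x < 1 := Real.rpow_lt_one_of_one_lt_of_neg hp1 (by linarith)
  have hgeom : Summable (fun e : ℕ => x ^ e) := summable_geometric_of_lt_one hx0.le hx1
  have hbound : ∀ e : ℕ, g (p ^ e) * x ^ e ≤ 2 * x ^ e := by
    intro e
    rcases Nat.eq_zero_or_pos e with rfl | he
    · rw [pow_zero, hg1]; norm_num
    · exact mul_le_mul_of_nonneg_right (htwo p e hp he) (pow_nonneg hx0.le e)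
  have hnn : ∀ e : ℕ, 0 ≤ g (p ^ e) * x ^ e := fun e => mul_nonneg (h0 _) (pow_nonneg hx0.le e)
  have hsum : Summable (fun e : ℕ => g (p ^ e) * x ^ e) :=
    Summable.of_nonneg_of_le hnn hbound (hgeom.mul_left 2)
  refine ⟨hsum, ?_⟩
  -- `Σ_e = g(1) + Σ_{e ≥ 1} ≤ 1 + 2 Σ_{e ≥ 1} x^e = 1 + 2x/(1 − x)`
  rw [hsum.tsum_eq_zero_add]
  have htail : ∑' e : ℕ, g (p ^ (e + 1)) * x ^ (e + 1) ≤ ∑' e : ℕ, 2 * x ^ (e + 1) := by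
    refine Summable.tsum_le_tsum (fun e => hbound (e + 1)) ?_ ?_
    · exact (summable_nat_add_iff 1).mpr hsum
    · exact ((summable_nat_add_iff 1).mpr hgeom).mul_left 2
  have hgeom1 : ∑' e : ℕ, 2 * x ^ (e + 1) = 2 * (x / (1 - x)) := by
    rw [tsum_mul_left]
    congr 1
    have : (fun e : ℕ => x ^ (e + 1)) = fun e : ℕ => x * x ^ e := funext fun e => by ring
    rw [this, tsum_mul_left, tsum_geometric_of_lt_one hx0.le hx1]
    field_simp
  rw [pow_zero, hg1, one_mul]
  have h1x : 0 < 1 - x := by linarith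
  calc 1 + ∑' e : ℕ, g (p ^ (e + 1)) * x ^ (e + 1) ≤ 1 + 2 * (x / (1 - x)) := by
        rw [← hgeom1]; linarith
    _ = (1 + x) / (1 - x) := by field_simp; ring
    _ ≤ ((1 - x)⁻¹) ^ 2 := by
        have hrepr : (1 + x) / (1 - x) = (1 - x ^ 2) * ((1 - x)⁻¹) ^ 2 := by
          field_simp; ring
        rw [hrepr]
        have hpos : 0 ≤ ((1 - x)⁻¹) ^ 2 := by positivity
        nlinarith [sq_nonneg x]

/-- **(5): the `l`-smooth terms, by Rankin's trick.** For `g` multiplicative, `≥ 0`, `g(p^k) ≤ 2`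
(`k ≥ 1`), `l ≥ 16` and `Z ≥ 1`:
`Σ_{Z ≤ a ≤ Y, a l-smooth} g(a)/a ≤ Z^{−1/log l} · exp(2(log log l + K₀))`
(`1/a ≤ Z^{−θ} a^{−(1−θ)}`, Euler product over smooth numbers, `∏ (1−p^{−σ})^{−2} ≤
exp(2(Σ_{p ≤ l} p^{−σ} + C₀))`, and `Σ_{p ≤ l} p^{−σ} ≤ log log l + M + 8/log l + 3 + 24 l^θ`,
`l^θ = e`). [cite: GoldfeldSchinzel1975, §2 proof of Lemma 1 (5) p. 574]
[cite: MontgomeryVaughan2007, §7.1 (Rankin's method)] -/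
theorem smooth_part_le {g : ArithmeticFunction ℝ} (hmul : g.IsMultiplicative) (h0 : ∀ n, 0 ≤ g n)
    (htwo : ∀ p k : ℕ, p.Prime → 1 ≤ k → g (p ^ k) ≤ 2)
    {l : ℕ} (hl : 16 ≤ l) {Z : ℝ} (hZ : 1 ≤ Z) (Y : ℝ) :
    ∑ a ∈ (Icc 1 ⌊Y⌋₊).filter (fun a : ℕ => Z ≤ (a : ℝ) ∧ a ∈ Nat.smoothNumbers (l + 1)),
        g a / (a : ℝ) ≤
      Z ^ (-(1 / Real.log l)) * Real.exp (2 * (Real.log (Real.log l) +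
        (meisselMertens + 8 / Real.log 16 + 3 + 24 * Real.exp 1 + RankinComposed.C₀))) := by
  have hlR : (16 : ℝ) ≤ l := by exact_mod_cast hl
  have hlog16 := log_sixteen_gt
  have hlogl : 2.77 < Real.log l := lt_of_lt_of_le hlog16 (Real.log_le_log (by norm_num) hlR)
  set θ : ℝ := 1 / Real.log l with hθ
  set σ : ℝ := 1 - θ with hσ
  have hθ0 : 0 < θ := by rw [hθ]; positivity
  have hθ25 : θ ≤ 2 / 5 := by
    rw [hθ, div_le_div_iff₀ (by linarith) (by norm_num)]; linarith
  have hθ1 : θ ≤ 1 / 2 := by linarith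
  have hσ35 : 3 / 5 ≤ σ := by rw [hσ]; linarith
  have hσ0 : 0 < σ := by linarith
  set N := ⌊Y⌋₊ with hN
  set A₂ := (Icc 1 N).filter (fun a : ℕ => Z ≤ (a : ℝ) ∧ a ∈ Nat.smoothNumbers (l + 1)) with hA₂
  -- Rankin: `g a / a ≤ Z^{-θ} · g a · a^{-σ}`
  have hstep1 : ∑ a ∈ A₂, g a / (a : ℝ) ≤ Z ^ (-θ) * ∑ a ∈ A₂, g a * (a : ℝ) ^ (-σ) := by
    rw [mul_sum]
    refine sum_le_sum fun a ha => ?_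
    rw [hA₂, mem_filter, mem_Icc] at ha
    obtain ⟨⟨ha1, -⟩, hZa, -⟩ := ha
    have ha0 : (0 : ℝ) < a := by exact_mod_cast ha1
    have hsplit : g a / (a : ℝ) = (a : ℝ) ^ (-θ) * (g a * (a : ℝ) ^ (-σ)) := by
      have : (a : ℝ)⁻¹ = (a : ℝ) ^ (-θ) * (a : ℝ) ^ (-σ) := by
        rw [← Real.rpow_add ha0, ← Real.rpow_neg_one]; congr 1; rw [hσ]; ring
      rw [div_eq_mul_inv, this]; ring
    rw [hsplit]
    refine mul_le_mul_of_nonneg_right ?_ (mul_nonneg (h0 _) (Real.rpow_nonneg ha0.le _))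
    exact Real.rpow_le_rpow_of_nonpos (by linarith) hZa (by linarith)
  -- Euler product over `l`-smooth numbers
  set h : ℕ → ℝ := fun n => g n * (n : ℝ) ^ (-σ) with hh
  have hh1 : h 1 = 1 := by simp [hh, hmul.map_one]
  have hhmul : ∀ {m n : ℕ}, Nat.Coprime m n → h (m * n) = h m * h n := by
    intro m n hmn
    simp only [hh]
    rw [hmul.map_mul_of_coprime hmn, Nat.cast_mul,
      Real.mul_rpow (Nat.cast_nonneg _) (Nat.cast_nonneg _)]
    ring
  have hh0 : ∀ n, 0 ≤ h n := fun n => mul_nonneg (h0 _) (Real.rpow_nonneg (Nat.cast_nonneg _) _)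
  have hhp : ∀ {p : ℕ} (e : ℕ), h (p ^ e) = g (p ^ e) * ((p : ℝ) ^ (-σ)) ^ e := by
    intro p e
    simp only [hh]
    have e1 : (((p ^ e : ℕ) : ℝ)) ^ (-σ) = (p : ℝ) ^ ((e : ℝ) * (-σ)) := by
      rw [Nat.cast_pow, ← Real.rpow_natCast (p : ℝ) e, ← Real.rpow_mul (Nat.cast_nonneg _)]
    have e2 : ((p : ℝ) ^ (-σ)) ^ e = (p : ℝ) ^ ((-σ) * (e : ℝ)) := by
      rw [← Real.rpow_natCast ((p : ℝ) ^ (-σ)) e, ← Real.rpow_mul (Nat.cast_nonneg _)]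
    rw [e1, e2, mul_comm (e : ℝ)]
  have hhsum : ∀ {p : ℕ}, p.Prime → Summable (fun e : ℕ => h (p ^ e)) := by
    intro p hp
    have := (tsum_local_le hmul.map_one h0 htwo hp hσ0).1
    exact this.congr fun e => (hhp e).symm
  have hstep2 : ∑ a ∈ A₂, h a ≤ ∏ p ∈ (l + 1).primesBelow, ∑' e : ℕ, h (p ^ e) := by
    refine BombieriSieve.sum_le_prod_tsum_of_factored hh1 hhmul hh0 hhsum
      (fun p hp => Nat.prime_of_mem_primesBelow hp) (fun a ha => ?_)
    rw [hA₂, mem_filter] at ha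
    rw [← Nat.smoothNumbers_eq_factoredNumbers_primesBelow]
    exact ha.2.2
  -- local factors `≤ ((1 − p^{−σ})⁻¹)²`
  have hstep3 : ∏ p ∈ (l + 1).primesBelow, ∑' e : ℕ, h (p ^ e) ≤
      (∏ p ∈ (l + 1).primesBelow, (1 - (p : ℝ) ^ (-σ))⁻¹) ^ 2 := by
    rw [← prod_pow]
    refine prod_le_prod (fun p _ => tsum_nonneg fun e => hh0 _) fun p hp => ?_
    have hpp := Nat.prime_of_mem_primesBelow hp
    have := (tsum_local_le hmul.map_one h0 htwo hpp hσ0).2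
    calc ∑' e : ℕ, h (p ^ e) = ∑' e : ℕ, g (p ^ e) * ((p : ℝ) ^ (-σ)) ^ e := tsum_congr fun e => hhp e
      _ ≤ _ := this
  -- `∏ (1 − p^{−σ})⁻¹ ≤ exp(Σ p^{−σ} + C₀)`
  have hprimes : ∀ p ∈ (l + 1).primesBelow, p.Prime := fun p hp => Nat.prime_of_mem_primesBelow hp
  have hstep4 := RankinComposed.prod_inv_le_exp hprimes hσ35
  -- `Σ_{p ≤ l} p^{−σ} ≤ log log l + M + 8/log l + 3 + 24e`
  have hstep5 : ∑ p ∈ (l + 1).primesBelow, (p : ℝ) ^ (-σ) ≤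
      Real.log (Real.log l) + meisselMertens + 8 / Real.log 16 + 3 + 24 * Real.exp 1 := by
    have hsplit : ∀ p ∈ (l + 1).primesBelow, (p : ℝ) ^ (-σ) = (p : ℝ)⁻¹ + ((p : ℝ) ^ θ - 1) / p := by
      intro p hp
      have hp0 : (0 : ℝ) < p := by exact_mod_cast (Nat.prime_of_mem_primesBelow hp).pos
      have : (p : ℝ) ^ (-σ) = (p : ℝ) ^ θ * (p : ℝ)⁻¹ := by
        rw [← Real.rpow_neg_one, ← Real.rpow_add hp0]; congr 1; rw [hσ]; ring
      rw [this]; field_simp; ring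
    rw [sum_congr rfl hsplit, sum_add_distrib]
    have hM : ∑ p ∈ (l + 1).primesBelow, (p : ℝ)⁻¹ ≤ Real.log (Real.log l) + meisselMertens + 8 / Real.log 16 := by
      have hmert := abs_primeRecipSum_sub_le (x := (l : ℝ)) (by linarith)
      have hps : primeRecipSum (l : ℝ) = ∑ p ∈ (l + 1).primesBelow, (p : ℝ)⁻¹ := by
        rw [primeRecipSum, Nat.floor_natCast]; rfl
      rw [abs_le] at hmert
      have h8 : 8 / Real.log l ≤ 8 / Real.log 16 :=
        div_le_div_of_nonneg_left (by norm_num) (by linarith) (Real.log_le_log (by norm_num) hlR)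
      linarith [hmert.2]
    have hE : ∑ p ∈ (l + 1).primesBelow, ((p : ℝ) ^ θ - 1) / p ≤ 3 + 24 * Real.exp 1 := by
      have h := RankinComposed.sum_excess_le (Q := l) (by omega) hθ0 hθ1
      have hlθ : (l : ℝ) ^ θ = Real.exp 1 := by
        rw [Real.rpow_def_of_pos (by linarith), hθ]
        congr 1; field_simp
      rw [hlθ] at h
      exact h
    linarith
  -- assemble
  have hZθ : 0 ≤ Z ^ (-θ) := Real.rpow_nonneg (by linarith) _
  have hprod0 : 0 ≤ ∏ p ∈ (l + 1).primesBelow, (1 - (p : ℝ) ^ (-σ))⁻¹ := by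
    refine prod_nonneg fun p hp => inv_nonneg.mpr ?_
    have hp1 : (1 : ℝ) < p := by exact_mod_cast (Nat.prime_of_mem_primesBelow hp).one_lt
    have : (p : ℝ) ^ (-σ) < 1 := Real.rpow_lt_one_of_one_lt_of_neg hp1 (by linarith)
    linarith
  calc ∑ a ∈ A₂, g a / (a : ℝ) ≤ Z ^ (-θ) * ∑ a ∈ A₂, h a := hstep1
    _ ≤ Z ^ (-θ) * (∏ p ∈ (l + 1).primesBelow, (1 - (p : ℝ) ^ (-σ))⁻¹) ^ 2 :=
        mul_le_mul_of_nonneg_left (hstep2.trans hstep3) hZθ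
    _ ≤ Z ^ (-θ) * (Real.exp (∑ p ∈ (l + 1).primesBelow, (p : ℝ) ^ (-σ) + RankinComposed.C₀)) ^ 2 := by
        gcongr
    _ ≤ Z ^ (-θ) * Real.exp (2 * (Real.log (Real.log l) +
        (meisselMertens + 8 / Real.log 16 + 3 + 24 * Real.exp 1 + RankinComposed.C₀))) := by
        refine mul_le_mul_of_nonneg_left ?_ hZθ
        rw [← Real.exp_nat_mul, Nat.cast_ofNat]
        exact Real.exp_le_exp.mpr (by linarith)
    _ = _ := by rw [hθ]

/-! ### The whole tail -/

/-- **Goldfeld–Schinzel's tail estimate ((3)–(5) combined).** For `g` multiplicative, `≥ 0`, with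
`g(p^{k+1}) ≤ 2g(p^k)` and `g(p^k) ≤ 2` (`k ≥ 1`) — e.g. the root count `ρ_D` of a fundamental
discriminant — and `1 ≤ Z ≤ Y ≤ l·Z`, `l ≥ 16`:
`Σ_{Z ≤ a ≤ Y} g(a)/a ≤ 2·((log(2Y/Z) + 16)/log(l/2))·Σ_{1 ≤ m < Z} g(m)/m
  + Z^{−1/log l}·exp(2(log log l + K₀))`.
With `Z = ¼√|d|`, `Y = Z f(d)`, `log l = log|d|/(21 log log|d|)` this is
`S ≪ ((log log|d|)²/log|d|) Σ' + (log|d|)^{−8}`, the source's (4) + (5).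
[cite: GoldfeldSchinzel1975, §2 proof of Lemma 1 (3)–(5) pp. 573–575] -/
theorem tail_le {g : ArithmeticFunction ℝ} (hmul : g.IsMultiplicative) (h0 : ∀ n, 0 ≤ g n)
    (hsucc : ∀ p k : ℕ, p.Prime → g (p ^ (k + 1)) ≤ 2 * g (p ^ k))
    (htwo : ∀ p k : ℕ, p.Prime → 1 ≤ k → g (p ^ k) ≤ 2)
    {l : ℕ} (hl : 16 ≤ l) {Z Y : ℝ} (hZ : 1 ≤ Z) (hZY : Z ≤ Y) (hYl : Y ≤ l * Z) :
    ∑ a ∈ (Icc 1 ⌊Y⌋₊).filter (fun a : ℕ => Z ≤ (a : ℝ)), g a / (a : ℝ) ≤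
      2 * ((Real.log (2 * Y / Z) + 16) / Real.log ((l : ℝ) / 2)) * ∑ m ∈ Ico 1 ⌈Z⌉₊, g m / (m : ℝ) +
      Z ^ (-(1 / Real.log l)) * Real.exp (2 * (Real.log (Real.log l) +
        (meisselMertens + 8 / Real.log 16 + 3 + 24 * Real.exp 1 + RankinComposed.C₀))) := by
  set N := ⌊Y⌋₊ with hN
  set A := (Icc 1 N).filter (fun a : ℕ => Z ≤ (a : ℝ)) with hA
  -- split `A` by "has a prime factor `> l`"
  have hsplit := (sum_filter_add_sum_filter_not A (fun a : ℕ => ∃ p ∈ a.primeFactors, l < p)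
    (fun a : ℕ => g a / (a : ℝ))).symm
  rw [hsplit]
  have hA1 : A.filter (fun a : ℕ => ∃ p ∈ a.primeFactors, l < p) =
      (Icc 1 N).filter (fun a : ℕ => Z ≤ (a : ℝ) ∧ ∃ p ∈ a.primeFactors, l < p) := by
    rw [hA, filter_filter]
  have hA2 : A.filter (fun a : ℕ => ¬ ∃ p ∈ a.primeFactors, l < p) ⊆
      (Icc 1 N).filter (fun a : ℕ => Z ≤ (a : ℝ) ∧ a ∈ Nat.smoothNumbers (l + 1)) := by
    intro a ha
    rw [hA, filter_filter, mem_filter, mem_Icc] at ha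
    obtain ⟨⟨ha1, haN⟩, hZa, hno⟩ := ha
    rw [mem_filter, mem_Icc]
    refine ⟨⟨ha1, haN⟩, hZa, ?_⟩
    rw [Nat.mem_smoothNumbers_iff_forall_le]
    refine ⟨by omega, fun p _ hp hpa => ?_⟩
    push Not at hno
    have := hno p (Nat.mem_primeFactors.mpr ⟨hp, hpa, by omega⟩)
    omega
  have h2 : ∑ a ∈ A.filter (fun a : ℕ => ¬ ∃ p ∈ a.primeFactors, l < p), g a / (a : ℝ) ≤
      ∑ a ∈ (Icc 1 N).filter (fun a : ℕ => Z ≤ (a : ℝ) ∧ a ∈ Nat.smoothNumbers (l + 1)),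
        g a / (a : ℝ) :=
    sum_le_sum_of_subset_of_nonneg hA2 fun a _ _ => div_nonneg (h0 _) (Nat.cast_nonneg _)
  rw [hA1]
  exact add_le_add (rough_part_le hmul h0 hsucc hl hZ hZY hYl) (h2.trans (smooth_part_le hmul h0 htwo hl hZ Y))

end Literature.NumberTheory.LFunctions.GSTail

end
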